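/-
COR-CM (cell pub-hodgecm2, stage 2 of the Hodge ladder) — count-neutral KERNEL COMBINATORICS «dicyclic twist, even order: the two closing squares read by
the strict-half functionals» (seat prover-pub-hodgecm2-b23-g43-0, binder prover b23, gen 43; claim DICYCLIC-EVEN, HOME/INBOX.md l.10881; blanket
`Census/DicyclicTwist*`).  Theorems only, on top of `Census/DicyclicTwistEvenMotion.lean` and part VIII of the odd lane
(`Census/DicyclicTwistGenerators.lean`, gen 42: the closing data `closData = (P; u, u′, u″)` with `|P| + 1 = |A|/2`, the squares `f₁`, `f₂`, their
`x`-translates `f₁x`, `f₂x` and `closingSpan` are parity-free and used BY NAME); no `decide`, no certificate, no named fact, no `sorry`.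
`Interfaces.lean` (C1), every E term, B01, `Transposition/*`, `PortJoin/*` untouched.
HONEST FRAMING: `HC_CM` is NOT proved, here or anywhere in the tree; nothing here is a period, a count of record or a headline.
T5: n/a-class (hypothesis binders: `|A|` even, `|A| ≥ 3`); checker: self, 2026-08-23.
-/
import Summits.HodgeConjecture.CorCM.Census.DicyclicTwistEvenReducing

/-!
# The dicyclic twist `Dic(ℤ/2 × A)`, `|A|` even, VI: the closing squares `f₁ = (0 | 𝟙_P; u, u′)`, `f₂ = (0 | 𝟙_{P∪u}; u′, u″)`

For `|A| = m` EVEN the closing data of gen 42 (`closData = (P; u, u′, u″)`, `|P| + 1 = m/2`, three distinct places outside `P`) put the two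
closing squares ACROSS THE EQUATOR: `f₁` has corners `(0, 𝟙_P)` (weight `m/2 − 1`), two conjugates of `(0, 𝟙_{P∪·})` (weight `m/2`: EQUATOR)
and `(0, 𝟙_{P∪{u,u′}})` (`m/2 + 1`); `f₂` has corners of weights `m/2, m/2 + 1, m/2 + 1, m/2 + 2`.  The strict-half functionals of
`Census/DicyclicTwistEvenFunctionals.lean` read them as follows (§3, `|A|` even `≥ 3`):

  `UE s f₁ = [s ∉ P ∪ {u, u′}]`,  `UE s f₂ = −[s ∉ P ∪ {u}]`,  so `UE s (f₁ + f₂) = −[s = u′]`;  `UX s f₁ = UX s f₂ = 0`;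
  `SE₁ f₁ = −2`,  `SE₁ f₂ = 2`,  `SE₀ f₁ = SE₀ f₂ = 0`;

and the `x`-translates `f₁x`, `f₂x` carry the mirrored values (`UX s f₁x = UE s f₁`, `SE₀ f₁x = −2`, …; §3, by `translX_rel`).
§1 computes the four functionals on any `1`-coordinate square over the passive constant `0`; §2 reads indicator types; §4 bounds the potential
on the closing span by `m/2` (every corner has a constant coordinate; translates preserve the potential) — so that the closing span is descended
WITHOUT touching the double equator (part VIII of this lane).  All [folklore].

## References
* [Pohlmann1968] H. Pohlmann, Algebraic cycles on abelian varieties of complex multiplication type, Ann. of Math. 88 (1968), Thm 1.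
-/

namespace Summit.HodgeConjecture.CorCM.Census.DicyclicTwist

open Finset
open Summit.HodgeConjecture.CorCM.Census.OddSliceFacesModel
open Summit.HodgeConjecture.CorCM.Census.OddSliceFacesSquares
open Summit.HodgeConjecture.CorCM.Census.OddSliceFacesDescent
open Summit.HodgeConjecture.CorCM.Census.EvenSliceFacesDescent

variable (A : Type) [AddCommGroup A] [Fintype A] [DecidableEq A]

/-! ## §1 The four functionals on a `1`-coordinate square over the passive constant `0` -/

omit [AddCommGroup A] [DecidableEq A] in
/-- `wE s (0, b) = [b up]·[b s = 0]` (`|A| ≥ 1`). [folklore] -/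
theorem wE_zero_left (h1 : 1 ≤ Fintype.card A) (s : A) (b : Ty A) : wE A s (0, b) = upI A b * (1 - dft A s b) := by
  unfold wE; rw [(loI_zero A h1).1, (loI_zero A h1).2]; ring

omit [DecidableEq A] in
/-- `wX s (0, b) = 0` (`|A| ≥ 1`). [folklore] -/
theorem wX_zero_left (h1 : 1 ≤ Fintype.card A) (s : A) (b : Ty A) : wX A s (0, b) = 0 := by
  unfold wX; rw [(loI_zero A h1).1, (loI_zero A h1).2, dft_zero]; ring

omit [AddCommGroup A] [DecidableEq A] in
/-- `wS₁ (0, b) = sg b + [b eq] = 1 − 2·[b up]` (`|A| ≥ 1`). [folklore] -/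
theorem wS₁_zero_left (h1 : 1 ≤ Fintype.card A) (b : Ty A) : wS₁ A (0, b) = 1 - 2 * upI A b := by
  unfold wS₁ sgI eqI; rw [(loI_zero A h1).1, (loI_zero A h1).2]; ring

omit [AddCommGroup A] [DecidableEq A] in
/-- `wS₀ (0, b) = 1` (`|A| ≥ 1`). [folklore] -/
theorem wS₀_zero_left (h1 : 1 ≤ Fintype.card A) (b : Ty A) : wS₀ A (0, b) = 1 := by
  unfold wS₀ sgI eqI; rw [(loI_zero A h1).1, (loI_zero A h1).2]; ring

omit [AddCommGroup A] [Fintype A] in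
/-- The conjugated corners of `(0 | φ; i, j)`: `(0 + 1, φ + 1 + δ i) = ((0, φ + δ i) conjugated)`. [folklore] -/
theorem bar_corner₁ (φ : Ty A) (i : A) : (((0 : Ty A) + 1, φ + 1 + δ A i) : Ty₂ A) = ((0 : Ty A) + 1, φ + δ A i + 1) := by
  rw [add_right_comm φ]

/-- **The four functionals on `(0 | φ; i, j)`** (`|A| ≥ 1`):
`UE s = Σ± [· up][· s = 0]` over the square of `φ`, `UX s = 0`, `SE₁ = −2·Σ± [· up]`, `SE₀ = 0`. [folklore] -/
theorem functionals_faceVec₁_zero (h1 : 1 ≤ Fintype.card A) (s : A) (φ : Ty A) (i j : A) :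
    UE A s (faceVec₁ A 0 φ i j) = upI A φ * (1 - dft A s φ) - upI A (φ + δ A i) * (1 - dft A s (φ + δ A i)) -
        upI A (φ + δ A j) * (1 - dft A s (φ + δ A j)) + upI A (φ + δ A i + δ A j) * (1 - dft A s (φ + δ A i + δ A j)) ∧
      UX A s (faceVec₁ A 0 φ i j) = 0 ∧
      SE₁ A (faceVec₁ A 0 φ i j) = -2 * (upI A φ - upI A (φ + δ A i) - upI A (φ + δ A j) + upI A (φ + δ A i + δ A j)) ∧
      SE₀ A (faceVec₁ A 0 φ i j) = 0 := by
  refine ⟨?_, ?_, ?_, ?_⟩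
  · rw [UE_apply, dot_faceVec₁, bar_corner₁, bar_corner₁, wE_conj, wE_conj, wE_zero_left A h1, wE_zero_left A h1, wE_zero_left A h1,
      wE_zero_left A h1]; ring
  · rw [UX_apply, dot_faceVec₁, bar_corner₁, bar_corner₁, wX_conj, wX_conj, wX_zero_left A h1, wX_zero_left A h1, wX_zero_left A h1,
      wX_zero_left A h1]; ring
  · rw [SE₁_apply, dot_faceVec₁, bar_corner₁, bar_corner₁, wS₁_conj, wS₁_conj, wS₁_zero_left A h1, wS₁_zero_left A h1, wS₁_zero_left A h1,
      wS₁_zero_left A h1]; ring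
  · rw [SE₀_apply, dot_faceVec₁, bar_corner₁, bar_corner₁, wS₀_conj, wS₀_conj, wS₀_zero_left A h1, wS₀_zero_left A h1, wS₀_zero_left A h1,
      wS₀_zero_left A h1]; ring

/-! ## §2 Indicator types -/

omit [AddCommGroup A] in
/-- The upper-half indicator of an indicator type. [folklore] -/
theorem upI_ind (Q : Finset A) : upI A (ind A Q) = if Fintype.card A < 2 * Q.card then 1 else 0 := by
  unfold upI; rw [wt_ind]

/-! ## §3 The closing squares of gen 42 read by the strict-half functionals, `|A|` even -/

section Even

variable {A}
variable (hev : Even (Fintype.card A)) (h3 : 3 ≤ Fintype.card A)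
include hev h3

/-- For `|A|` even, `|P| + 1 = |A|/2` reads `2(|P| + 1) = |A|`. [folklore] -/
theorem two_mul_closCard : 2 * ((closData A).1.card + 1) = Fintype.card A := by
  have hP := (closData_spec A h3).1
  obtain ⟨k, hk⟩ := hev
  omega

/-- **`UE`, `UX`, `SE₁`, `SE₀` of `f₁`**: `UE s f₁ = [s ∉ P ∪ {u,u′}]`, `UX s f₁ = 0`, `SE₁ f₁ = −2`, `SE₀ f₁ = 0`. [folklore] -/
theorem functionals_f₁ (s : A) :
    UE A s (f₁ A) = (if s = (closData A).2.2.1 ∨ s = (closData A).2.1 ∨ s ∈ (closData A).1 then 0 else 1) ∧ UX A s (f₁ A) = 0 ∧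
      SE₁ A (f₁ A) = -2 ∧ SE₀ A (f₁ A) = 0 := by
  obtain ⟨hP, hu, hu', hu'', huu', huu'', hu'u''⟩ := closData_spec A h3
  have hm := two_mul_closCard hev h3
  have h1 : 1 ≤ Fintype.card A := by omega
  obtain ⟨c1, c2, c3⟩ := corners₁ hu hu' huu'
  obtain ⟨k1, k2, k3, -, -⟩ := cards hu hu' hu'' huu' huu'' hu'u''
  obtain ⟨vE, vX, v1, v0⟩ := functionals_faceVec₁_zero A h1 s (ind A (closData A).1) (closData A).2.1 (closData A).2.2.1
  unfold f₁
  refine ⟨?_, vX, ?_, v0⟩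
  · rw [vE, c3, c1, c2]
    simp only [upI_ind, dft_ind, k1, k2, k3, Finset.mem_insert]
    have e0 : ¬ (Fintype.card A < 2 * (closData A).1.card) := by omega
    have e1 : ¬ (Fintype.card A < 2 * ((closData A).1.card + 1)) := by omega
    have e2 : Fintype.card A < 2 * ((closData A).1.card + 2) := by omega
    simp only [e0, e1, e2, ↓reduceIte, zero_mul, sub_zero, one_mul, zero_add]
    by_cases hs : s = (closData A).2.2.1 ∨ s = (closData A).2.1 ∨ s ∈ (closData A).1
    · rw [if_pos hs, if_pos hs]; ring
    · rw [if_neg hs, if_neg hs]; ring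
  · rw [v1, c3, c1, c2]
    simp only [upI_ind, k1, k2, k3]
    have e0 : ¬ (Fintype.card A < 2 * (closData A).1.card) := by omega
    have e1 : ¬ (Fintype.card A < 2 * ((closData A).1.card + 1)) := by omega
    have e2 : Fintype.card A < 2 * ((closData A).1.card + 2) := by omega
    simp only [e0, e1, e2, ↓reduceIte]; ring

/-- **`UE`, `UX`, `SE₁`, `SE₀` of `f₂`**: `UE s f₂ = −[s ∉ P ∪ {u}]`, `UX s f₂ = 0`, `SE₁ f₂ = 2`, `SE₀ f₂ = 0`. [folklore] -/
theorem functionals_f₂ (s : A) :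
    UE A s (f₂ A) = (if s = (closData A).2.1 ∨ s ∈ (closData A).1 then 0 else -1) ∧ UX A s (f₂ A) = 0 ∧
      SE₁ A (f₂ A) = 2 ∧ SE₀ A (f₂ A) = 0 := by
  obtain ⟨hP, hu, hu', hu'', huu', huu'', hu'u''⟩ := closData_spec A h3
  have hm := two_mul_closCard hev h3
  have h1 : 1 ≤ Fintype.card A := by omega
  obtain ⟨d1, d2, d3⟩ := corners₂ hu' hu'' huu' huu'' hu'u''
  obtain ⟨k1, -, k3, k4, k5⟩ := cards hu hu' hu'' huu' huu'' hu'u''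
  obtain ⟨vE, vX, v1, v0⟩ := functionals_faceVec₁_zero A h1 s (ind A (insert (closData A).2.1 (closData A).1)) (closData A).2.2.1
    (closData A).2.2.2
  unfold f₂
  refine ⟨?_, vX, ?_, v0⟩
  · rw [vE, d3, d1, d2]
    simp only [upI_ind, dft_ind, k1, k3, k4, k5, Finset.mem_insert]
    have e1 : ¬ (Fintype.card A < 2 * ((closData A).1.card + 1)) := by omega
    have e2 : Fintype.card A < 2 * ((closData A).1.card + 2) := by omega
    have e3 : Fintype.card A < 2 * ((closData A).1.card + 3) := by omega
    simp only [e1, e2, e3, ↓reduceIte, zero_mul, one_mul, zero_sub]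
    by_cases hs1 : s = (closData A).2.2.1
    · subst hs1; simp [huu'.symm, hu'u'', hu']
    · by_cases hs2 : s = (closData A).2.2.2
      · subst hs2; simp [huu''.symm, hu'', Ne.symm hu'u'']
      · by_cases hs3 : s = (closData A).2.1 ∨ s ∈ (closData A).1
        · rw [if_pos hs3]; simp [hs1, hs2, hs3]
        · rw [if_neg hs3]; simp [hs1, hs2, hs3]
  · rw [v1, d3, d1, d2]
    simp only [upI_ind, k1, k3, k4, k5]
    have e1 : ¬ (Fintype.card A < 2 * ((closData A).1.card + 1)) := by omega
    have e2 : Fintype.card A < 2 * ((closData A).1.card + 2) := by omega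
    have e3 : Fintype.card A < 2 * ((closData A).1.card + 3) := by omega
    simp only [e1, e2, e3, ↓reduceIte]; ring

/-- **`UE s (f₁ + f₂) = −[s = u′]`, and the other functionals of `f₁ + f₂` vanish.** [folklore] -/
theorem functionals_f₁_add_f₂ (s : A) :
    UE A s (f₁ A + f₂ A) = (if s = (closData A).2.2.1 then -1 else 0) ∧ UX A s (f₁ A + f₂ A) = 0 ∧ SE₁ A (f₁ A + f₂ A) = 0 ∧
      SE₀ A (f₁ A + f₂ A) = 0 := by
  obtain ⟨-, hu, hu', -, huu', -, -⟩ := closData_spec A h3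
  obtain ⟨aE, aX, a1, a0⟩ := functionals_f₁ hev h3 s
  obtain ⟨bE, bX, b1, b0⟩ := functionals_f₂ hev h3 s
  refine ⟨?_, by rw [map_add, aX, bX, add_zero], by rw [map_add, a1, b1]; ring, by rw [map_add, a0, b0, add_zero]⟩
  rw [map_add, aE, bE]
  by_cases hs : s = (closData A).2.2.1
  · subst hs; simp [huu'.symm, hu']
  · by_cases hs' : s = (closData A).2.1 ∨ s ∈ (closData A).1
    · rw [if_pos (Or.inr hs'), if_pos hs', if_neg hs]; ring
    · rw [if_neg (by tauto), if_neg hs', if_neg hs]; ring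

/-- **The `x`-translates**: `UX s f₁x = UE s f₁`, `UE s f₁x = 0`, `SE₀ f₁x = −2`, `SE₁ f₁x = 0`, and the same for `f₂x` with `SE₀ f₂x = 2`.
[folklore] -/
theorem functionals_fx (s : A) :
    (UE A s (f₁x A) = 0 ∧ UX A s (f₁x A) = UE A s (f₁ A) ∧ SE₀ A (f₁x A) = -2 ∧ SE₁ A (f₁x A) = 0) ∧
      (UE A s (f₂x A) = 0 ∧ UX A s (f₂x A) = UE A s (f₂ A) ∧ SE₀ A (f₂x A) = 2 ∧ SE₁ A (f₂x A) = 0) := by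
  obtain ⟨-, aX, a1, a0⟩ := functionals_f₁ hev h3 s
  obtain ⟨-, bX, b1, b0⟩ := functionals_f₂ hev h3 s
  have r1 := translX_rel A (f₁ A)
  have r2 := translX_rel A (f₂ A)
  rw [translX_f₁] at r1
  rw [translX_f₂] at r2
  exact ⟨⟨by rw [r1.1, aX, neg_zero], r1.2.1 s, by rw [r1.2.2.2, a1], by rw [r1.2.2.1, a0, neg_zero]⟩,
    ⟨by rw [r2.1, bX, neg_zero], r2.2.1 s, by rw [r2.2.2.2, b1], by rw [r2.2.2.1, b0, neg_zero]⟩⟩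

end Even

/-! ## §4 The potential on the closing span -/

omit [AddCommGroup A] in
/-- The support of a `1`-coordinate square consists of its four corners. [folklore] -/
theorem eq_corner_of_faceVec₁_ne_zero {ψ φ : Ty A} {i j : A} {χ : Ty₂ A} (h : faceVec₁ A ψ φ i j χ ≠ 0) :
    χ = (ψ, φ) ∨ χ = (ψ + 1, φ + 1 + δ A i) ∨ χ = (ψ + 1, φ + 1 + δ A j) ∨ χ = (ψ, φ + δ A i + δ A j) := by
  by_contra hc
  simp only [not_or] at hc
  apply h
  simp only [faceVec₁, Pi.add_apply, Pi.single_apply, if_neg hc.1, if_neg hc.2.1, if_neg hc.2.2.1, if_neg hc.2.2.2, add_zero]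

omit [DecidableEq A] in
/-- A label with a constant `0`-coordinate has potential `≤ |A|/2`. [folklore] -/
theorem pot_le_half_of_fst_const {a : Ty A} (ha : a = 0 ∨ a = 1) (b : Ty A) : pot A (a, b) ≤ Fintype.card A / 2 := by
  have hb := clsTy_le A b
  have hwb := wt_le A b
  have ha0 : clsTy A a = 0 := by
    rcases ha with rfl | rfl
    · unfold clsTy; rw [wt_zero]; simp
    · rw [← zero_add (1 : Ty A), clsTy_add_one]; unfold clsTy; rw [wt_zero]; simp
  show clsTy A a + clsTy A b ≤ Fintype.card A / 2
  omega

/-- The supports of `f₁`, `f₂` have potential `≤ |A|/2`. [folklore] -/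
theorem pot_le_half_of_f_ne_zero {χ : Ty₂ A} (h : f₁ A χ ≠ 0 ∨ f₂ A χ ≠ 0) : pot A χ ≤ Fintype.card A / 2 := by
  have h01 : ((0 : Ty A) = 0 ∨ (0 : Ty A) = 1) := Or.inl rfl
  have h11 : ((0 : Ty A) + 1 = 0 ∨ (0 : Ty A) + 1 = 1) := Or.inr (zero_add 1)
  rcases h with h | h
  · unfold f₁ at h
    rcases eq_corner_of_faceVec₁_ne_zero A h with rfl | rfl | rfl | rfl
    · exact pot_le_half_of_fst_const A h01 _
    · exact pot_le_half_of_fst_const A h11 _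
    · exact pot_le_half_of_fst_const A h11 _
    · exact pot_le_half_of_fst_const A h01 _
  · unfold f₂ at h
    rcases eq_corner_of_faceVec₁_ne_zero A h with rfl | rfl | rfl | rfl
    · exact pot_le_half_of_fst_const A h01 _
    · exact pot_le_half_of_fst_const A h11 _
    · exact pot_le_half_of_fst_const A h11 _
    · exact pot_le_half_of_fst_const A h01 _

/-- **Every vector of the closing span is supported in potential `≤ |A|/2`** (hence off the double equator). [folklore] -/
theorem pot_le_half_of_mem_closingSpan {n : Ty₂ A → ℤ} (hn : n ∈ closingSpan A) : ∀ χ, n χ ≠ 0 → pot A χ ≤ Fintype.card A / 2 := by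
  refine Submodule.span_induction (p := fun w _ => ∀ χ, w χ ≠ 0 → pot A χ ≤ Fintype.card A / 2) ?_ ?_ ?_ ?_ hn
  · rintro _ ⟨g, h⟩ χ hχ
    have hH : ∀ (v : Ty₂ A → ℤ), (∀ χ', v χ' ≠ 0 → pot A χ' ≤ Fintype.card A / 2) → translH A g v χ ≠ 0 → pot A χ ≤ Fintype.card A / 2 :=
      fun v hv hne => by
        have := hv _ hne
        rwa [pot_twH] at this
    have hX : ∀ (v : Ty₂ A → ℤ), (∀ χ', v χ' ≠ 0 → pot A χ' ≤ Fintype.card A / 2) →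
        ∀ χ', translX A v χ' ≠ 0 → pot A χ' ≤ Fintype.card A / 2 := fun v hv χ' hne => by
      have h1 := hv _ hne
      have h2 : pot A (twX A (twXinv A χ')) = pot A (twXinv A χ') := pot_twX A _
      rw [twX_twXinv] at h2
      rw [h2]; exact h1
    have b1 : ∀ χ', f₁ A χ' ≠ 0 → pot A χ' ≤ Fintype.card A / 2 := fun χ' h' => pot_le_half_of_f_ne_zero A (Or.inl h')
    have b2 : ∀ χ', f₂ A χ' ≠ 0 → pot A χ' ≤ Fintype.card A / 2 := fun χ' h' => pot_le_half_of_f_ne_zero A (Or.inr h')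
    rcases h with rfl | rfl | rfl | rfl
    · exact hH _ b1 hχ
    · exact hH _ b2 hχ
    · rw [← translX_f₁] at hχ; exact hH _ (hX _ b1) hχ
    · rw [← translX_f₂] at hχ; exact hH _ (hX _ b2) hχ
  · intro χ h; exact absurd rfl h
  · intro x y _ _ hx hy χ hχ
    by_cases h : x χ = 0
    · exact hy χ (by rw [Pi.add_apply, h, zero_add] at hχ; exact hχ)
    · exact hx χ h
  · intro c x _ hx χ hχ
    exact hx χ (fun h => hχ (by rw [Pi.smul_apply, h, smul_zero]))

end Summit.HodgeConjecture.CorCM.Census.DicyclicTwist
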